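/- Fleet lead `ym-wcr-19456-p1`, route `WeakCouplingRates`, crux `ColdBoxTwoPointFloorW` (stmt-QuantumFields-19608). -/
import Summits.QuantumFields.YangMills.Theorems.WeakCouplingRatesColdBoxDirichletPosDef
import Literature.MathematicalPhysics.QuantumFieldTheory.GaussianToolkit

/-!
# Crux `ColdBoxTwoPointFloor(W)`, assembly step (b) inputs: the Dirichlet Gaussian D1' as an EXPLICIT DENSITY and the vanishing of
# non-touching plaquettes

* `boxDirichlet_eq_withDensity` — `boxDirichlet H = Z⁻¹ · e^{−½ tᵀQ_D t} dt` on `ℝ^{DirFree H}`, `Z ∈ (0,∞)` (tree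
  `GaussianToolkit.multivariateGaussian_inv_eq_withDensity` at `posDef_dirQmat`); `gaussWeight_dirQmat` — the exponent is the Dirichlet
  form `Σ_{p ⊆ enlarged box} s(p)²` (`LatticeMaxwell.formM … 0`), i.e. after `t = √(2β)·v` exactly the Gaussian weight `e^{−β Σ_p |s_p(v)|²}`
  (per colour component) that the chart step produces;
* `sCirc_dirGlue_eq_zero_of_not_touching` — a plaquette of `ℤ⁴` that does not touch the cold box `Λ` has circulation `0` under the glued
  Dirichlet field (all its edges are pinned), so the form is effectively the sum over `plaquettesTouching Λ` — the index set of the Wilson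
  boundary action `wilsonBoundaryAction ρ Λ` in `boxState`.
Everything proved; no definition; standard axioms.
-/

set_option autoImplicit false

noncomputable section

open MeasureTheory Matrix Finset
open scoped ENNReal
open Literature.MathematicalPhysics.QuantumLattice
open Literature.MathematicalPhysics.QuantumFieldTheory
open Literature.MathematicalPhysics.QuantumFieldTheory.LatticeMaxwell
open Literature.MathematicalPhysics.QuantumFieldTheory.AxialGauge
open Literature.MathematicalPhysics.QuantumFieldTheory.GaussianToolkit

namespace Summit.QuantumFields.YangMills.Theorems.WeakCouplingRates

variable {H : ℕ}

/-- **D1' as an explicit density**: `boxDirichlet H = Z⁻¹ · e^{−½ tᵀ Q_D t} dt` on `ℝ^{DirFree H}` with `Z ∈ (0, ∞)` (the tree's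
`GaussianToolkit.multivariateGaussian_inv_eq_withDensity` at the positive definite `Q_D`, `posDef_dirQmat`). -/
theorem boxDirichlet_eq_withDensity (H : ℕ) :
    boxDirichlet H = (gaussZ (Qmat (fun e => e ∉ dirFreeEdges H) dirCorner (2 * H + 3)))⁻¹ •
        (volume : Measure (EuclideanSpace ℝ (DirFree H))).withDensity
          (gaussWeight (Qmat (fun e => e ∉ dirFreeEdges H) dirCorner (2 * H + 3))) ∧
      gaussZ (Qmat (fun e => e ∉ dirFreeEdges H) dirCorner (2 * H + 3)) ≠ 0 ∧
      gaussZ (Qmat (fun e => e ∉ dirFreeEdges H) dirCorner (2 * H + 3)) ≠ ∞ :=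
  multivariateGaussian_inv_eq_withDensity (posDef_dirQmat H)

/-- The exponent of that density is the Dirichlet form: `tᵀ Q_D t = Σ_{p ⊆ big box} s(p)²` (`LatticeMaxwell.dotProduct_Qmat_mulVec`). -/
theorem gaussWeight_dirQmat (t : EuclideanSpace ℝ (DirFree H)) :
    gaussWeight (Qmat (fun e => e ∉ dirFreeEdges H) dirCorner (2 * H + 3)) t =
      ENNReal.ofReal (Real.exp (-(formM (fun e => e ∉ dirFreeEdges H) dirCorner (2 * H + 3) 0 (WithLp.ofLp t)) / 2)) := by
  rw [gaussWeight, dotProduct_Qmat_mulVec]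

/-- **Plaquettes of the enlarged box that do not touch the cold box contribute nothing**: all four of their edges are pinned to `0`. -/
theorem sCirc_dirGlue_eq_zero_of_not_touching (s : DirFree H → ℝ) {p : ZdPlaquette 4}
    (hp : p ∉ plaquettesTouching (boxEdges 4 (2 * H + 1))) :
    sCirc (dirGlue H s) (p.1, p.2.1.1, p.2.1.2) = 0 := by
  rw [mem_plaquettesTouching_iff, Finset.not_nonempty_iff_eq_empty] at hp
  have hnot : ∀ e ∈ plaquetteEdges p, e ∉ boxEdges 4 (2 * H + 1) := fun e he hmem => by
    have : e ∈ plaquetteEdges p ∩ boxEdges 4 (2 * H + 1) := Finset.mem_inter.2 ⟨he, hmem⟩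
    rw [hp] at this; simp at this
  have h1 := dirGlue_eq_zero_of_not_mem s (hnot (p.1, p.2.1.1) (by simp [plaquetteEdges]))
  have h2 := dirGlue_eq_zero_of_not_mem s (hnot (p.1 + Pi.single p.2.1.1 1, p.2.1.2) (by simp [plaquetteEdges]))
  have h3 := dirGlue_eq_zero_of_not_mem s (hnot (p.1 + Pi.single p.2.1.2 1, p.2.1.1) (by simp [plaquetteEdges]))
  have h4 := dirGlue_eq_zero_of_not_mem s (hnot (p.1, p.2.1.2) (by simp [plaquetteEdges]))
  simp only [sCirc, h1, h2, h3, h4, sub_self, add_zero]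

/-! ## Appended 2026-08-26: Gaussian-weighted integrals as `Z ·` Dirichlet expectations (assembly step (b)) -/


/-- **Gaussian-weighted Lebesgue integrals are `Z ·` Dirichlet expectations**: for measurable `g ≥ 0`,
`∫ g(t) e^{−½ tᵀQ_D t} dt = Z · E_{boxDirichlet}[g]` — the identification used in step (b) of the assembly (after the chart and the
rescaling `t = √(2β)·v`, the one-colour Gaussian weight `e^{−β Σ_p s_p(v)²} = e^{−½ Σ_p s_p(t)²}` integrates to `Z` times a D1'
expectation). -/
theorem lintegral_mul_gaussWeight_eq (H : ℕ) (g : EuclideanSpace ℝ (DirFree H) → ℝ≥0∞) (hg : Measurable g) :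
    ∫⁻ t, g t * gaussWeight (Qmat (fun e => e ∉ dirFreeEdges H) dirCorner (2 * H + 3)) t ∂(volume : Measure (EuclideanSpace ℝ (DirFree H))) =
      gaussZ (Qmat (fun e => e ∉ dirFreeEdges H) dirCorner (2 * H + 3)) * ∫⁻ t, g t ∂(boxDirichlet H) := by
  obtain ⟨hτ, hZ0, hZtop⟩ := boxDirichlet_eq_withDensity H
  set Q := Qmat (fun e => e ∉ dirFreeEdges H) dirCorner (2 * H + 3) with hQ
  rw [hτ, lintegral_smul_measure, lintegral_withDensity_eq_lintegral_mul _ (measurable_gaussWeight Q) hg]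
  simp only [Pi.mul_apply, smul_eq_mul]
  rw [← mul_assoc, ENNReal.mul_inv_cancel hZ0 hZtop, one_mul]
  refine lintegral_congr fun t => ?_
  rw [mul_comm]

/-- The same for real-valued integrands via `integral`: `∫ g e^{−½tᵀQ_Dt} dt = Z.toReal · E_D[g]` for integrable… (lintegral form above is
the one used; this corollary records the normalised-probability reading `E_D[g] = Z⁻¹ ∫ g·w`). -/
theorem lintegral_boxDirichlet_eq (H : ℕ) (g : EuclideanSpace ℝ (DirFree H) → ℝ≥0∞) (hg : Measurable g) :
    ∫⁻ t, g t ∂(boxDirichlet H) =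
      (gaussZ (Qmat (fun e => e ∉ dirFreeEdges H) dirCorner (2 * H + 3)))⁻¹ *
        ∫⁻ t, g t * gaussWeight (Qmat (fun e => e ∉ dirFreeEdges H) dirCorner (2 * H + 3)) t
          ∂(volume : Measure (EuclideanSpace ℝ (DirFree H))) := by
  obtain ⟨-, hZ0, hZtop⟩ := boxDirichlet_eq_withDensity H
  rw [lintegral_mul_gaussWeight_eq H g hg, ← mul_assoc, ENNReal.inv_mul_cancel hZ0 hZtop, one_mul]


end Summit.QuantumFields.YangMills.Theorems.WeakCouplingRates

end
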